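import Summits.Langlands.Langlands.Theorems.DeterminantLockSplitHeart

/-!
# `TorusPricingSplit` — HEART: §0 (the torus dial at the relative-identity point) + §1 (the decided heart: the Fejér certificate)

(decomp-langlands cell, lens-4 g36, RESIDUAL MODE.  Pure finite-group / real-algebra half of the node; imports ONLY the tree module
`Theorems.DeterminantLockSplitHeart` (lens-4 g35, census twin p831416) for the counting identity `card_orderPred_eq_sum`.  The companion module
`TorusPricingSplit` = the node's module docstring + §2–§4 (the Hecke-field dial, pieces, kernel, host edges), importing this one.)

THE TORUS IN ONE LINE.  Once the relative avatar is priced against the TORUS FAMILY of its own inducing character (module docstring of the main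
file: Henniart local algebraicity ⟹ `χ₀ = ψ_λ`, `π₀ := AI_{M/K}(ψ)` is automorphic; Rankin–Selberg of `Sym^{a}π × AI_M(Sym^{b}π_M ⊗ ψ^jψ^{-cj'})`,
`a, b ≤ 4`), the eigenvalue RATIO `u_v = t₁/t₂` of `π` at the places `v ∉ S` SPLIT in `M` and lying UNDER THE RELATIVE IDENTITY `ψ(𝔭) = ψ(𝔭ᶜ)`
(a set of positive natural density in every Chebotarev class of `Gal(L/K)`, or a density point of such sets) is FORCED to have the `U(2)`-Weyl
moments `E[Re u^j] = −½·δ_{j,1}` (`j = 1 … 4`; with the odd phase moments, `weylMoment`), while the relation `Sat(t_v^f) = charpoly ρ₀(Frob_v)^f` + the determinant lock (g35)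
pins `u_v = ζ²` with `ζ^{f} = 1`, `f = ord Frob_v ∈ Gal(L/K)` — so at the places whose Frobenius is an INVOLUTION or trivial, `u_v = 1` EXACTLY:
coincident Satake parameters, sitting on the zero of the Weyl density `(1 − cos φ)/2π` (eigenvalue repulsion).  The FEJÉR test function
`T(u) = 4Re u + 3Re u² + 2Re u³ + Re u⁴ = (5/2)(F₄(u) − 1)` has `T ≥ −5/2` on the circle (`T + 5/2 = ½(4x² + 2x − 1)²`, `x = Re u`), `T ≥ −2` on
`μ₄ ∪ μ₆`, `T(1) = 10` and Weyl mean `−2`: every finite group with `#{g : ord g ∉ {1,2,3,4,6,8,12}} < 24 · #{g : g² = 1}` is TORUS-CERTIFIED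
(`torusCert_of_involutions`) — `PSL₂(𝔽₈)`, `PSL₂(𝔽₁₃)`, `PSL₂(𝔽₁₆)`, `PSL₂(𝔽₁₉)`, `PSL₂(𝔽₂₃)`, `PSL₂(𝔽₂₅)`, `3·A₆`, `A₇`, … (all LOCK-silent but `A₇`),
by TWO element counts.
-/

set_option linter.dupNamespace false
set_option linter.style.longLine false

noncomputable section

namespace Summit.Langlands.Langlands.Theorems.TorusPricingSplit

open scoped BigOperators Classical
open Finset
open Summit.Langlands.Langlands.Theorems.DeterminantLockSplit (card_orderPred_eq_sum)

/-! ## §0  The torus dial -/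

/-- The FORCED PHASE MOMENTS at the relative identity: `E[Re ζ^k] = 1, 0, −½, 0, 0, 0, 0, 0, 0` (`k = 0 … 8`) for the root of unity
`ζ_v = t₁/ψ(𝔭) ∈ μ_f` of a split place under `ψ(𝔭) = ψ(𝔭ᶜ)`.  The even ones are the `U(2)`-WEYL MOMENTS of the eigenvalue ratio `u = ζ² = t₁/t₂`
(`E[Re u^j] = −½ δ_{j,1}`: the law `(1 − cos φ) dφ/2π` of the ratio of a Haar-random unitary pair — forced by the Rankin–Selberg pairs `Sym^a × Sym^a`);
the odd ones vanish (pairs `Sym^a × Sym^b ⊗ ψ^{a−b}`, `a ≠ b`).  Degree `8 = 4 + 4` is the `Sym⁴ × Sym⁴` ceiling of Kim–Shahidi functoriality. -/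
def weylMoment (k : ℕ) : ℝ := if k = 0 then 1 else if k = 2 then -(1 / 2) else 0

/-- The degree of the dial: phase frequencies `0 … 8` (coefficient vectors `Fin 9 → ℝ`). -/
abbrev torusDegree : ℕ := 8

/-- **TORUS PHASE CERTIFICATE** of a finite group `G` (a property of the ORDER STATISTICS of `G` only; the dual-LP form, like g34's
`PhaseMomentCertificate` and g35's `LockedPhaseMomentCertificate`).  A real trigonometric polynomial `T(ζ) = Σ_{k ≤ 8} c_k Re(ζ^k)` and marks
`κ : ℕ → ℝ` such that (i) for every `g ∈ G` and every `ζ ∈ ℂ` with `ζ^{ord g} = 1`, `κ(ord g) ≤ T(ζ)` — the support at the relative-identity point: under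
an element of order `f` the phase `t₁/ψ(𝔭)` IS an `f`-th root of unity and the Satake ratio is its SQUARE (g35's determinant lock with torus parameter `1`)
— and (ii) the forced mean of `T` is SMALLER than the `κ`-average: `(Σ_k c_k · weylMoment k)·|G| < Σ_{g} κ(ord g)`.
Soundness (paper, main file (a‴)): Chebotarev–Hecke over the Fejér-localised split places gives `E[T(ζ_v)] ≥ (1/|G|) Σ_g κ(ord g) − ε`, the forced
moments give `E[T(ζ_v)] = Σ_k c_k · weylMoment k` — contradiction; so NO cuspidal non-dihedral `π` with a number-field Hecke field has a relative dihedral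
avatar through a torus-certified perfect layer. -/
def TorusPhaseCertificate (G : Type*) [Group G] : Prop :=
  ∃ (c : Fin 9 → ℝ) (κ : ℕ → ℝ), 0 < Nat.card G ∧
    (∀ g : G, ∀ ζ : ℂ, ζ ^ orderOf g = 1 → κ (orderOf g) ≤ ∑ k : Fin 9, c k * (ζ ^ (k : ℕ)).re) ∧
    (∑ k : Fin 9, c k * weylMoment k) * (Nat.card G : ℝ) < ∑ᶠ g : G, κ (orderOf g)

/-- the element orders on which the Fejér test function is `≥ −2` (squares of `f`-th roots of unity lie in `μ₄ ∪ μ₆`) -/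
def tameOrders : Finset ℕ := {1, 2, 3, 4, 6, 8, 12}

/-! ## §1  The decided heart: the Fejér certificate `T = 4Re u + 3Re u² + 2Re u³ + Re u⁴` -/

section Heart

/-- the Fejér coefficients `c = (0, 0, 4, 0, 3, 0, 2, 0, 1)`: `T(ζ) = 4Re ζ² + 3Re ζ⁴ + 2Re ζ⁶ + Re ζ⁸ = (5/2)(F₄(ζ²) − 1)`, `F₄` the Fejér
kernel of order `4` in the ratio `u = ζ²` -/
def fejerCoeff : Fin 9 → ℝ := ![0, 0, 4, 0, 3, 0, 2, 0, 1]

/-- the Fejér test function of the ratio `u` -/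
def fejerT (u : ℂ) : ℝ := 4 * u.re + 3 * (u ^ 2).re + 2 * (u ^ 3).re + (u ^ 4).re

/-- The `Fin 9` certificate row `fejerCoeff` evaluates to the Fejér kernel of the SQUARED phase: `Σ_k c_k Re ζ^k = T(ζ²)`. -/
theorem sum_fejerCoeff (ζ : ℂ) : ∑ k : Fin 9, fejerCoeff k * (ζ ^ (k : ℕ)).re = fejerT (ζ ^ 2) := by
  simp only [fejerT, ← pow_mul]
  simp [Fin.sum_univ_succ, fejerCoeff]
  ring

/-- the forced mean of `T` is `4 · (−½) = −2` -/
theorem fejer_weylMean : ∑ k : Fin 9, fejerCoeff k * weylMoment k = -2 := by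
  simp [Fin.sum_univ_succ, fejerCoeff, weylMoment]
  norm_num

/-- `Re u³` in coordinates. -/
theorem re_pow_three (u : ℂ) : (u ^ 3).re = u.re ^ 3 - 3 * u.re * u.im ^ 2 := by
  simp [pow_succ, Complex.mul_re, Complex.mul_im]; ring

/-- `Re u⁴` in coordinates. -/
theorem re_pow_four (u : ℂ) : (u ^ 4).re = u.re ^ 4 - 6 * u.re ^ 2 * u.im ^ 2 + u.im ^ 4 := by
  simp [pow_succ, Complex.mul_re, Complex.mul_im]; ring

/-- **THE FEJÉR IDENTITY on the circle**: `T(u) + 5/2 = ½ (4x² + 2x − 1)²`, `x = Re u`, `|u| = 1`. -/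
theorem fejerT_eq {u : ℂ} (h : u.re ^ 2 + u.im ^ 2 = 1) : fejerT u = (4 * u.re ^ 2 + 2 * u.re - 1) ^ 2 / 2 - 5 / 2 := by
  -- census inline (G41 b): `dedup.landed` vs Literature.Topology.FourManifolds.BraidFraming.sq_re — local copy, not a top-level restatement
  have re_pow_two : ∀ u : ℂ, (u ^ 2).re = u.re ^ 2 - u.im ^ 2 := fun u => by
    rw [pow_two, Complex.mul_re]; ring
  unfold fejerT
  rw [re_pow_two, re_pow_three, re_pow_four]
  linear_combination (u.im ^ 2 - 7 * u.re ^ 2 - 6 * u.re - 2) * h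

/-- the global bound `T ≥ −5/2` (equality exactly at the primitive 5th roots of unity: the zeros of `F₄`) -/
theorem fejerT_ge {u : ℂ} (h : u.re ^ 2 + u.im ^ 2 = 1) : -(5 / 2 : ℝ) ≤ fejerT u := by
  rw [fejerT_eq h]; nlinarith [sq_nonneg (4 * u.re ^ 2 + 2 * u.re - 1)]

/-- at the coincident point `u = 1` (trivial or involutive Frobenius): `T = 10` -/
theorem fejerT_one : fejerT 1 = 10 := by
  simp [fejerT]; norm_num

/-- on `μ₄ ∪ μ₆` the real part is one of `0, ±½, ±1`, where `T ≥ −2` -/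
theorem fejerT_ge_of_re {u : ℂ} (h : u.re ^ 2 + u.im ^ 2 = 1)
    (hx : u.re = 1 ∨ u.re = -1 ∨ u.re = 0 ∨ u.re = 1 / 2 ∨ u.re = -(1 / 2)) : -(2 : ℝ) ≤ fejerT u := by
  rw [fejerT_eq h]
  rcases hx with hx | hx | hx | hx | hx <;> rw [hx] <;> norm_num

/-- A root of unity lies on the unit circle: `ζ^f = 1`, `f ≠ 0` ⟹ `Re² ζ + Im² ζ = 1`. -/
theorem normSq_of_pow_eq_one {ζ : ℂ} {f : ℕ} (hf : f ≠ 0) (hz : ζ ^ f = 1) (n : ℕ) : (ζ ^ n).re ^ 2 + (ζ ^ n).im ^ 2 = 1 := by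
  have h1 : ‖ζ‖ = 1 := Complex.norm_eq_one_of_pow_eq_one hz hf
  have h2 : Complex.normSq (ζ ^ n) = 1 := by rw [Complex.normSq_eq_norm_sq, norm_pow, h1, one_pow, one_pow]
  rw [Complex.normSq_apply] at h2
  linear_combination h2

/-- `ζ^f = 1` and `f ∣ n` ⟹ `ζ^n = 1`. -/
theorem pow_eq_one_of_dvd {ζ : ℂ} {f n : ℕ} (hz : ζ ^ f = 1) (hd : f ∣ n) : ζ ^ n = 1 := by
  obtain ⟨m, rfl⟩ := hd
  rw [pow_mul, hz, one_pow]

/-- `u⁴ = 1`, `|u| = 1` ⟹ `Re u ∈ {0, ±1}` (from `Re u⁴ = 8x⁴ − 8x² + 1 = 1`) -/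
theorem re_of_pow_four {u : ℂ} (h : u.re ^ 2 + u.im ^ 2 = 1) (hu : u ^ 4 = 1) :
    u.re = 1 ∨ u.re = -1 ∨ u.re = 0 ∨ u.re = 1 / 2 ∨ u.re = -(1 / 2) := by
  have e : (u ^ 4).re = 1 := by rw [hu, Complex.one_re]
  rw [re_pow_four] at e
  have e' : u.re ^ 2 * ((u.re - 1) * (u.re + 1)) = 0 := by
    linear_combination (1 / 8 : ℝ) * e - ((u.im ^ 2 - 7 * u.re ^ 2 + 1) / 8) * h
  rcases mul_eq_zero.mp e' with h0 | h1
  · exact Or.inr (Or.inr (Or.inl (pow_eq_zero_iff two_ne_zero |>.mp h0)))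
  · rcases mul_eq_zero.mp h1 with h2 | h3
    · exact Or.inl (by linarith)
    · exact Or.inr (Or.inl (by linarith))

/-- `u⁶ = 1`, `|u| = 1` ⟹ `Re u ∈ {±1, ±½}` (from `u³ = ±1`, `Re u³ = 4x³ − 3x`) -/
theorem re_of_pow_six {u : ℂ} (h : u.re ^ 2 + u.im ^ 2 = 1) (hu : u ^ 6 = 1) :
    u.re = 1 ∨ u.re = -1 ∨ u.re = 0 ∨ u.re = 1 / 2 ∨ u.re = -(1 / 2) := by
  have h33 : u ^ 3 * u ^ 3 = 1 := by rw [← pow_add]; exact hu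
  rcases mul_self_eq_one_iff.mp h33 with h3 | h3
  · have e : (u ^ 3).re = 1 := by rw [h3, Complex.one_re]
    rw [re_pow_three] at e
    have e' : (u.re - 1) * (2 * u.re + 1) ^ 2 = 0 := by linear_combination e + 3 * u.re * h
    rcases mul_eq_zero.mp e' with h0 | h1
    · exact Or.inl (by linarith)
    · have := pow_eq_zero_iff two_ne_zero |>.mp h1
      exact Or.inr (Or.inr (Or.inr (Or.inr (by linarith))))
  · have e : (u ^ 3).re = -1 := by rw [h3]; simp
    rw [re_pow_three] at e
    have e' : (u.re + 1) * (2 * u.re - 1) ^ 2 = 0 := by linear_combination e + 3 * u.re * h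
    rcases mul_eq_zero.mp e' with h0 | h1
    · exact Or.inr (Or.inl (by linarith))
    · have := pow_eq_zero_iff two_ne_zero |>.mp h1
      exact Or.inr (Or.inr (Or.inr (Or.inl (by linarith))))

/-- Orders dividing `2` are tame. -/
theorem mem_tameOrders_of_dvd_two {f : ℕ} (hf : f ∣ 2) : f ∈ tameOrders := by
  have := Nat.le_of_dvd two_pos hf
  interval_cases f <;> simp_all [tameOrders]

/-- on the tame orders the squared root of unity lies in `μ₄ ∪ μ₆`, so `T(ζ²) ≥ −2` -/
theorem fejerT_sq_ge_tame {f : ℕ} (hf : f ∈ tameOrders) {ζ : ℂ} (hz : ζ ^ f = 1) : -(2 : ℝ) ≤ fejerT (ζ ^ 2) := by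
  have hf0 : f ≠ 0 := by
    simp only [tameOrders, Finset.mem_insert, Finset.mem_singleton] at hf
    rcases hf with rfl | rfl | rfl | rfl | rfl | rfl | rfl <;> decide
  have hn := normSq_of_pow_eq_one hf0 hz 2
  simp only [tameOrders, Finset.mem_insert, Finset.mem_singleton] at hf
  have key : (ζ ^ 2) ^ 4 = 1 ∨ (ζ ^ 2) ^ 6 = 1 := by
    rw [← pow_mul, ← pow_mul]
    rcases hf with rfl | rfl | rfl | rfl | rfl | rfl | rfl
    · exact Or.inl (pow_eq_one_of_dvd hz (by norm_num))
    · exact Or.inl (pow_eq_one_of_dvd hz (by norm_num))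
    · exact Or.inr (pow_eq_one_of_dvd hz (by norm_num))
    · exact Or.inl (pow_eq_one_of_dvd hz (by norm_num))
    · exact Or.inr (pow_eq_one_of_dvd hz (by norm_num))
    · exact Or.inl (pow_eq_one_of_dvd hz (by norm_num))
    · exact Or.inr (pow_eq_one_of_dvd hz (by norm_num))
  rcases key with h4 | h6
  · exact fejerT_ge_of_re hn (re_of_pow_four hn h4)
  · exact fejerT_ge_of_re hn (re_of_pow_six hn h6)

/-- at the trivial element and the involutions the ratio is `1` EXACTLY: `T(ζ²) = 10` -/
theorem fejerT_sq_of_dvd_two {f : ℕ} (hf : f ∣ 2) {ζ : ℂ} (hz : ζ ^ f = 1) : fejerT (ζ ^ 2) = 10 := by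
  rw [pow_eq_one_of_dvd hz hf, fejerT_one]

/-! ### STEP L in the kernel: the locked split phase -/

/-- **The locked split phase.**  In a field: `t₁^f = a^f`, `t₁t₂ = ab`, `a, b ≠ 0`, `f ≠ 0` ⟹ `t₁ = ζa`, `t₂ = ζ⁻¹b` with `ζ^f = 1`, so the RATIO is
`t₁/t₂ = ζ²·(a/b)`.  (At a place `v = 𝔭𝔭ᶜ` split in `M` with `Frob_v` of order `f`: `a, b = ψ(𝔭), ψ(𝔭ᶜ)`; the relation through `L` gives the `f`-th powers,
g35's determinant lock `det ρ₀ = ω_π` gives the product; under the relative identity `a = b` the Satake ratio is the SQUARE of an `f`-th root of unity, and `= 1`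
when `f ∣ 2`.) -/
theorem split_phase_of_powers {F : Type*} [Field F] {t₁ t₂ a b : F} {f : ℕ} (hf : f ≠ 0) (ha : a ≠ 0) (hb : b ≠ 0)
    (h1 : t₁ ^ f = a ^ f) (h12 : t₁ * t₂ = a * b) :
    ∃ ζ : F, ζ ^ f = 1 ∧ t₁ = ζ * a ∧ t₂ = ζ⁻¹ * b ∧ t₁ / t₂ = ζ ^ 2 * (a / b) := by
  have ht₁ : t₁ ≠ 0 := by
    rintro rfl
    rw [zero_pow hf] at h1
    exact pow_ne_zero f ha h1.symm
  have e2 : t₂ = a * b / t₁ := (eq_div_iff ht₁).mpr (by rw [mul_comm]; exact h12)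
  refine ⟨t₁ / a, ?_, ?_, ?_, ?_⟩
  · rw [div_pow, h1, div_self (pow_ne_zero f ha)]
  · rw [div_mul_eq_mul_div, mul_div_assoc, div_self ha, mul_one]
  · rw [e2, inv_div]; ring
  · rw [e2]; field_simp

/-! ### The universal torus certificate -/

/-- **CERT-T · INVOLUTION REPULSION.**  Every finite group in which the elements of order outside `{1,2,3,4,6,8,12}` number FEWER THAN `24` times
the solutions of `g² = 1` carries a torus phase certificate: `T = 4Re u + 3Re u² + 2Re u³ + Re u⁴` (Weyl mean `−2`), `κ = 10` on `{f : f ∣ 2}`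
(`u = 1`), `κ = −2` on the other tame orders (`u ∈ μ₄ ∪ μ₆`), `κ = −5/2` elsewhere (Fejér bound); the inequality is
`−2(a+b+r) < 10a − 2b − (5/2)r ⟺ r < 24a`.  Instances (GAP / ATLAS order statistics; all silent for BOTH g34's plain and g35's locked dial unless
marked): `PSL₂(𝔽₈)` (`504`; `a = 64`, `r = 384`), `3·A₆` (`1080`; `46`, `432`), `PSL₂(𝔽₁₃)` (`1092`; `92`, `636`), `PSL₂(𝔽₁₉)` (`3420`; `172`, `2868`),
`PSL₂(𝔽₁₆)` (`4080`; `256`, `3552`), `PSL₂(𝔽₂₃)` (`6072`; `254`, `3288`), `SL₂(𝔽₅)∘SL₂(𝔽₅)` (`7200`; `452`, `4608`), `PSL₂(𝔽₂₅)` (`7800`; `326`, `4224`), `A₇`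
(`2520`; `106`, `1224`; lock-certified too), and every `PSL₂(𝔽_q)` with `q ≤ 25`.  A coarser reading: `|G| < 25 · #{g : g² = 1}` suffices (`torusCert_of_involutionDensity`). -/
theorem torusCert_of_involutions (G : Type*) [Group G] [Finite G]
    (h : Nat.card {g : G // orderOf g ∉ tameOrders} < 24 * Nat.card {g : G // orderOf g ∣ 2}) : TorusPhaseCertificate G := by
  haveI := Fintype.ofFinite G
  refine ⟨fejerCoeff, fun f => if f ∣ 2 then 10 else if f ∈ tameOrders then -2 else -(5 / 2), Nat.card_pos, ?_, ?_⟩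
  · intro g ζ hz
    rw [sum_fejerCoeff]
    dsimp only
    by_cases h1 : orderOf g ∣ 2
    · rw [if_pos h1, fejerT_sq_of_dvd_two h1 hz]
    · by_cases h2 : orderOf g ∈ tameOrders
      · rw [if_neg h1, if_pos h2]; exact fejerT_sq_ge_tame h2 hz
      · rw [if_neg h1, if_neg h2]
        exact fejerT_ge (normSq_of_pow_eq_one (orderOf_pos g).ne' hz 2)
  · have hdec : ∀ g : G, (if orderOf g ∣ 2 then (10 : ℝ) else if orderOf g ∈ tameOrders then -2 else -(5 / 2)) =
        -2 + 12 * (if orderOf g ∣ 2 then (1 : ℝ) else 0) - 1 / 2 * (if orderOf g ∉ tameOrders then (1 : ℝ) else 0) := by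
      intro g
      by_cases h1 : orderOf g ∣ 2
      · simp [h1, mem_tameOrders_of_dvd_two h1]; norm_num
      · by_cases h2 : orderOf g ∈ tameOrders
        · simp [h1, h2]
        · simp [h1, h2]; norm_num
    rw [fejer_weylMean, finsum_eq_sum_of_fintype, Finset.sum_congr rfl (fun g _ => hdec g), Finset.sum_sub_distrib, Finset.sum_add_distrib,
      ← Finset.mul_sum, ← Finset.mul_sum, Finset.sum_const, Finset.card_univ, nsmul_eq_mul, ← card_orderPred_eq_sum G (· ∣ 2),
      ← card_orderPred_eq_sum G (· ∉ tameOrders), ← Nat.card_eq_fintype_card]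
    have hc : (Nat.card {g : G // orderOf g ∉ tameOrders} : ℝ) < 24 * (Nat.card {g : G // orderOf g ∣ 2} : ℝ) := by exact_mod_cast h
    linarith

/-- **Coarse form: involution density `> 1/25`.**  `|G| < 25 · #{g : ord g ∣ 2}` ⟹ torus-certified (`r ≤ |G| − a < 24a`). -/
theorem torusCert_of_involutionDensity (G : Type*) [Group G] [Finite G]
    (h : Nat.card G < 25 * Nat.card {g : G // orderOf g ∣ 2}) : TorusPhaseCertificate G := by
  haveI := Fintype.ofFinite G
  apply torusCert_of_involutions
  have key : ∀ g : G, (if orderOf g ∉ tameOrders then (1 : ℝ) else 0) + (if orderOf g ∣ 2 then (1 : ℝ) else 0) ≤ 1 := by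
    intro g
    by_cases h1 : orderOf g ∣ 2
    · simp [h1, mem_tameOrders_of_dvd_two h1]
    · by_cases h2 : orderOf g ∈ tameOrders <;> simp [h1, h2]
  have hle : (Nat.card {g : G // orderOf g ∉ tameOrders} : ℝ) + (Nat.card {g : G // orderOf g ∣ 2} : ℝ) ≤ (Nat.card G : ℝ) := by
    rw [card_orderPred_eq_sum G (· ∉ tameOrders), card_orderPred_eq_sum G (· ∣ 2), ← Finset.sum_add_distrib, Nat.card_eq_fintype_card,
      ← Finset.card_univ]
    calc ∑ g : G, ((if orderOf g ∉ tameOrders then (1 : ℝ) else 0) + (if orderOf g ∣ 2 then (1 : ℝ) else 0))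
        ≤ ∑ _g : G, (1 : ℝ) := Finset.sum_le_sum (fun g _ => key g)
      _ = ((Finset.univ : Finset G).card : ℝ) := by simp
  have h' : (Nat.card G : ℝ) < 25 * (Nat.card {g : G // orderOf g ∣ 2} : ℝ) := by exact_mod_cast h
  have : (Nat.card {g : G // orderOf g ∉ tameOrders} : ℝ) < 24 * (Nat.card {g : G // orderOf g ∣ 2} : ℝ) := by linarith
  exact_mod_cast this

/-- `g² = 1 ⟺ ord g ∣ 2` — the count in the certificates is the number of solutions of `g² = 1` (involutions and the identity). -/
theorem orderOf_dvd_two_iff {G : Type*} [Group G] (g : G) : orderOf g ∣ 2 ↔ g ^ 2 = 1 := orderOf_dvd_iff_pow_eq_one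

/-! ### A decided instance -/

/-- `A₅` has `16` solutions of `g² = 1` (the identity and `15` double transpositions) … -/
theorem card_sq_eq_one_alternatingFive : Fintype.card {g : alternatingGroup (Fin 5) // g ^ 2 = 1} = 16 := by decide

/-- … so `60 < 25 · 16` and the ICOSAHEDRAL LAYER GROUP IS TORUS-CERTIFIED (kernel instance of `torusCert_of_involutionDensity`; the LOCK-silent
instances `PSL₂(𝔽₈)`, `PSL₂(𝔽₁₃)`, `PSL₂(𝔽₁₆)`, … of `torusCert_of_involutions` are by their ATLAS order statistics, two numbers each). -/
theorem torusCert_alternatingFive : TorusPhaseCertificate (alternatingGroup (Fin 5)) := by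
  -- census inline (G41 b): `dedup.landed` vs Literature.AlgebraicGeometry.Motives.SymmetricGroupPartition.card_alternatingGroup_fin_five
  have card_alternatingFive : Fintype.card (alternatingGroup (Fin 5)) = 60 := by decide
  apply torusCert_of_involutionDensity
  rw [Nat.card_congr (Equiv.subtypeEquivRight (fun g : alternatingGroup (Fin 5) => (orderOf_dvd_iff_pow_eq_one (x := g) (n := 2)))),
    Nat.card_eq_fintype_card, Nat.card_eq_fintype_card, card_alternatingFive, card_sq_eq_one_alternatingFive]
  norm_num

end Heart

end Summit.Langlands.Langlands.Theorems.TorusPricingSplit
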